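import Literature.Probability.LatticeModels.SubcriticalFourier
import HarnessLib

/-!
# Log-convexity of the two-point function in a lattice direction (the spectral representation, Aizenman–Duminil-Copin 2021, Prop. 5.3, as used in Prop. 5.9)

Topic `Literature/Probability/LatticeModels`; family `crit-ising`. No named fact, no sorry; the
only definitions are the quadratic forms `torusAxisForm` / `axisForm` below.

The gradient estimate of Aizenman–Duminil-Copin 2021 (arXiv:1912.07973, **Proposition 5.9**) rests
on one consequence of the spectral representation of the two-point function (ibid.,
**Proposition 5.3**, eq. (5.17): "for every square summable `v : ℤ^{d-1} → ℂ` there exists a positive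
measure `μ_{v,β}` … such that for every `n ∈ ℤ`,
`∑_{x_⊥,y_⊥} v_{x_⊥} \overline{v_{y_⊥}} S_{ρ,β}((n, x_⊥ - y_⊥)) = ∫ e^{-a|n|} dμ_{v,β}(a)`"), namely
(proof of Prop. 5.9, p. 19): "The spectral representation applied to the function `v` being the sum
of the Dirac functions at `0_⊥` and `x_⊥` implies the existence of a finite measure `μ_{x_⊥,β}` such
that `w_n = ∫_0^∞ e^{-na} dμ_{x_⊥,β}(a)`. Cauchy–Schwarz gives `w_n² ≤ w_{n-1} w_{n+1}`".

This file proves that log-convexity directly, for every finitely supported real `v`, without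
constructing the spectral measure:

* on the torus `(ℤ/Nℤ)^{d'+1}` (`N ≥ 3`, `β ≥ 0`, zero field) the quadratic form
  `W_N(n) = ∑_{a,b} c_a c_b ⟨σ_{x̄_a} σ_{x̄_b + n e_i}⟩_{𝕋_N;β}` of the periodic two-point function,
  for lattice points `x_a` in the hyperplane `{x_i = 0}`, is **exactly** log-convex in
  `1 ≤ n ≤ N - 2` (`torusAxisForm_sq_le`): by the transfer-matrix representation of
  `TorusTransferSpectral` (`sum_exp_mul_layerObs_eq_trace`, `trace_diagonal_pow_diagonal_pow_eq_sum`),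
  `Z · W_N(n) = Tr(diag F · Aⁿ · diag F · A^{N-n}) = ∑_{k,l} c_{kl} λ_lⁿ λ_k^{N-n}` with `c_{kl} ≥ 0`
  and `λ ≥ 0` (the transfer matrix is positive semidefinite), each term is log-linear in `n`, and a
  sum of log-convex sequences is log-convex (Cauchy–Schwarz) — this is the finite-volume content of
  Prop. 5.3 / Prop. A.6 (Appendix A.3, "the positivity of the transfer matrix");
* in infinite volume (`axisForm_sq_le`): for the nearest-neighbour Ising model on `ℤ^{d'+1}` at any
  `β ≥ 0` with `m*(β) = 0` — every `β < β_c`, and `β = β_c` when `d' + 1 ≥ 3` — the form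
  `W(n) = ∑_{a,b} c_a c_b S(x_b - x_a + n e_i)`, `S = ⟨σ₀σ_·⟩⁺_β = twoPointPlus`, satisfies
  `W(n)² ≤ W(n-1) W(n+1)` for all `n ≥ 1`, by the convergence of the periodic two-point function to
  the infinite-volume one (`TorusTwoPointLimit`, ADC Prop. 5.2);
* the instance used by Prop. 5.9 (`twoPointPlus_axisPair_sq_le`): for `x_⊥` in the hyperplane,
  `w_n = S(n e_i) + S(x_⊥ + n e_i)` is log-convex in `n ≥ 1` (take `c = (1,1)` at the points `0, x_⊥`;
  the cross terms are equal by reflection invariance).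

## References

* M. Aizenman, H. Duminil-Copin, Ann. of Math. 194 (2021) = arXiv:1912.07973, §5.3 Prop. 5.3
  (eq. (5.17)), §5.5 Prop. 5.9 (proof, "Cauchy–Schwarz gives `w_n² ≤ w_{n-1}w_{n+1}`"), Appendix A.3
  Prop. A.6 [AizenmanDuminilCopinAnnals2021] (held; read pp. 17–19, 32).
* J. Glimm, A. Jaffe, *Quantum Physics*, §6 (transfer matrix and spectral representation) — through
  `TorusTransferSpectral`.

## Mathlib

`Finset.sum_mul_sq_le_sq_mul_sq` (Cauchy–Schwarz), `Real.sqrt_mul`, `Real.sqrt_sq`,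
`le_of_tendsto_of_tendsto`, `Filter.Tendsto.mul`, `tendsto_finsetSum`.
-/

noncomputable section

open MeasureTheory Filter Topology Finset Matrix

namespace Literature.Probability.LatticeModels

/-! ### Part 1. Sums of log-linear sequences are log-convex -/

section Algebra

variable {κ : Type*} [Fintype κ]

/-- **A non-negative combination of the sequences `n ↦ μⁿ λ^{N-n}` is log-convex**: for
`c_{kl}, λ_k ≥ 0` and `G(n) = ∑_{k,l} c_{kl} λ_lⁿ λ_k^{N-n}`, `G(n)² ≤ G(n-1) G(n+1)` whenever
`1 ≤ n ≤ N - 1` (each term satisfies it with equality; Cauchy–Schwarz). This is the mechanism of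
"Cauchy–Schwarz gives `w_n² ≤ w_{n-1}w_{n+1}`" in the proof of ADC Prop. 5.9, at the level of the
transfer-matrix spectral sum. [cite: AizenmanDuminilCopinAnnals2021, arXiv:1912.07973 §5.5, proof of Prop. 5.9 (p. 19)] -/
theorem spectralSum_sq_le (c : κ → κ → ℝ) (ev : κ → ℝ) (hc : ∀ k l, 0 ≤ c k l) (hev : ∀ k, 0 ≤ ev k)
    {N n : ℕ} (hn : 1 ≤ n) (hnN : n + 1 ≤ N) :
    (∑ k, ∑ l, c k l * (ev l ^ n * ev k ^ (N - n))) ^ 2 ≤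
      (∑ k, ∑ l, c k l * (ev l ^ (n - 1) * ev k ^ (N - (n - 1)))) *
        ∑ k, ∑ l, c k l * (ev l ^ (n + 1) * ev k ^ (N - (n + 1))) := by
  classical
  -- exponents: `n = q+1`, `N - (n+1) = p`, `N - n = p + 1`, `N - (n-1) = p + 2`
  obtain ⟨q, rfl⟩ : ∃ q, n = q + 1 := ⟨n - 1, by omega⟩
  set p : ℕ := N - (q + 1 + 1) with hp
  have h1 : q + 1 - 1 = q := by omega
  have h2 : N - (q + 1) = p + 1 := by omega
  have h3 : N - q = p + 2 := by omega
  rw [h1, h2, h3]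
  -- the terms as functions on `κ × κ`
  set t : κ × κ → ℕ → ℕ → ℝ := fun kl i j => c kl.1 kl.2 * (ev kl.2 ^ i * ev kl.1 ^ j) with ht
  have ht0 : ∀ kl i j, 0 ≤ t kl i j := fun kl i j =>
    mul_nonneg (hc _ _) (mul_nonneg (pow_nonneg (hev _) _) (pow_nonneg (hev _) _))
  have hflat : ∀ i j : ℕ, ∑ k, ∑ l, c k l * (ev l ^ i * ev k ^ j) = ∑ kl : κ × κ, t kl i j := by
    intro i j
    rw [Fintype.sum_prod_type]
  rw [hflat, hflat, hflat]
  -- termwise: `t(q+1, p+1) = √t(q, p+2) · √t(q+2, p)` (log-linearity)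
  have hterm : ∀ kl, Real.sqrt (t kl q (p + 2)) * Real.sqrt (t kl (q + 1 + 1) p) = t kl (q + 1) (p + 1) := by
    intro kl
    rw [← Real.sqrt_mul (ht0 kl q (p + 2)),
      show t kl q (p + 2) * t kl (q + 1 + 1) p = t kl (q + 1) (p + 1) ^ 2 by simp only [ht]; ring,
      Real.sqrt_sq (ht0 kl _ _)]
  have key := Finset.sum_mul_sq_le_sq_mul_sq (Finset.univ : Finset (κ × κ))
    (fun kl => Real.sqrt (t kl q (p + 2))) (fun kl => Real.sqrt (t kl (q + 1 + 1) p))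
  simp only [hterm, Real.sq_sqrt (ht0 _ _ _)] at key
  exact key

end Algebra

/-! ### Part 2. The torus: exact log-convexity of axis forms of the periodic two-point function -/

section Torus

variable {d' N : ℕ} [NeZero N]

/-- Free zero-field expectations on the torus as Boltzmann averages (real observables):
`⟨F⟩_{𝕋_N;β,h} = Z⁻¹ ∑_σ e^{-βH(σ)} F(σ)`. [cite: FriedliVelenik2017, §3.1, eq. (3.8)] -/
theorem isingExpect_torus_eq_sum (β h : ℝ) (F : SpinConfig (TorusSite (d' + 1) N) → ℝ) :
    isingExpect (torusGraph (d' + 1) N) Finset.univ β h .free F =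
      (isingPartitionFunction (torusGraph (d' + 1) N) Finset.univ β h .free)⁻¹ *
        ∑ σ : SpinConfig (TorusSite (d' + 1) N), torusWeight β h σ * F σ := by
  classical
  have key := integral_isingMeasure_univ_free (G := torusGraph (d' + 1) N) β h (fun σ => ((F σ : ℝ) : ℂ))
  rw [integral_complex_ofReal] at key
  have key' := congrArg Complex.re key
  rw [Complex.ofReal_re] at key'
  rw [isingExpect, key', Finset.smul_sum]
  simp only [Complex.real_smul, Complex.re_sum, Complex.mul_re, Complex.ofReal_re, Complex.ofReal_im,
    mul_zero, sub_zero, torusWeight, Finset.mul_sum]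
  refine Finset.sum_congr rfl fun σ _ => ?_
  simp only [Complex.ofReal_re, Complex.ofReal_im, Complex.mul_im, mul_zero, zero_mul, add_zero]
  ring

/-- The torus two-point function as a Boltzmann average:
`⟨σ_xσ_y⟩_{𝕋_N;β,h} = Z⁻¹ ∑_σ e^{-βH(σ)} σ_x σ_y`. [cite: FriedliVelenik2017, §3.1, eq. (3.8)] -/
theorem isingTorusTwoPoint_eq_sum (β h : ℝ) (x y : TorusSite (d' + 1) N) :
    isingTorusTwoPoint (d' + 1) N β h x y =
      (isingPartitionFunction (torusGraph (d' + 1) N) Finset.univ β h .free)⁻¹ *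
        ∑ σ : SpinConfig (TorusSite (d' + 1) N), torusWeight β h σ * (spinAt x σ * spinAt y σ) := by
  rw [isingTorusTwoPoint, isingTwoPoint, isingExpect_torus_eq_sum]
  rfl

omit [NeZero N] in
/-- Inserting the `i`-th coordinate `s` into the remaining coordinates of a torus site `x` with
`x_i = 0` gives the translate `x + s e_i`. [folklore] -/
theorem Torus.ins_removeNth_eq_add_single (i : Fin (d' + 1)) (x : TorusSite (d' + 1) N) (hx : x i = 0)
    (s : ZMod N) : Torus.ins i s (i.removeNth x) = x + Pi.single i s := by
  have h := Torus.ins_self_removeNth i x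
  rw [hx] at h
  calc Torus.ins i s (i.removeNth x) = Torus.ins i (0 + s) (i.removeNth x) := by rw [zero_add]
    _ = Torus.ins i 0 (i.removeNth x) + Pi.single i s := by
        funext j
        refine Fin.succAboveCases i ?_ (fun j' => ?_) j
        · simp
        · simp [Fin.succAbove_ne]
    _ = x + Pi.single i s := by rw [h]

/-- **The axis form of the periodic two-point function** in the direction `e_i`: for coefficients
`c_a` at torus sites `x_a`, `W_N(n) = ∑_{a,b} c_a c_b ⟨σ_{x_a} σ_{x_b + n e_i}⟩_{𝕋_N;β}` (zero field).
[cite: AizenmanDuminilCopinAnnals2021, arXiv:1912.07973 Prop. 5.3, eq. (5.17) (the quadratic form in v)] -/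
def torusAxisForm (β : ℝ) (i : Fin (d' + 1)) {ι : Type*} [Fintype ι] (c : ι → ℝ)
    (x : ι → TorusSite (d' + 1) N) (n : ZMod N) : ℝ :=
  ∑ a, ∑ b, c a * c b * isingTorusTwoPoint (d' + 1) N β 0 (x a) (x b + Pi.single i n)

/-- **Transfer-matrix representation of the axis form**: for `N ≥ 3`, sites `x_a` in the layer
`{x_i = 0}` and the layer observable `F(r) = ∑_a c_a r_{x_a}`,
`Z · W_N(n) = Tr(diag F · A^{n} · diag F · A^{N-n})` (`A` the symmetrised transfer matrix in the
direction `e_i`). [cite: AizenmanDuminilCopinAnnals2021, arXiv:1912.07973 Appendix A.3, Prop. A.6 (spectral representation via the transfer matrix)] -/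
theorem Z_mul_torusAxisForm_eq_trace (hN : 3 ≤ N) (β : ℝ) (i : Fin (d' + 1)) {ι : Type*} [Fintype ι]
    (c : ι → ℝ) (x : ι → TorusSite (d' + 1) N) (hx : ∀ a, x a i = 0) (n : ZMod N) :
    isingPartitionFunction (torusGraph (d' + 1) N) Finset.univ β 0 .free * torusAxisForm β i c x n =
      (diagonal (fun r : Layer d' N => ∑ a, c a * spinAt (i.removeNth (x a)) r) *
          transferMatrix β 0 ^ n.val *
        diagonal (fun r : Layer d' N => ∑ a, c a * spinAt (i.removeNth (x a)) r) *
          transferMatrix β 0 ^ (N - n.val)).trace := by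
  classical
  set F : Layer d' N → ℝ := fun r => ∑ a, c a * spinAt (i.removeNth (x a)) r with hF
  have hZpos : 0 < isingPartitionFunction (torusGraph (d' + 1) N) Finset.univ β 0 .free :=
    isingPartitionFunction_pos _ _ β 0 _
  rw [← sum_exp_mul_layerObs_eq_trace hN i β 0 F F n]
  -- expand the layer observables
  have hlayer : ∀ (σ : SpinConfig (TorusSite (d' + 1) N)) (s : ZMod N),
      F (layerOf i σ s) = ∑ a, c a * spinAt (x a + Pi.single i s) σ := by
    intro σ s
    simp only [hF]
    refine Finset.sum_congr rfl fun a _ => ?_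
    rw [← spinAt_ins i σ s, Torus.ins_removeNth_eq_add_single i (x a) (hx a) s]
  have hlayer0 : ∀ (σ : SpinConfig (TorusSite (d' + 1) N)), F (layerOf i σ 0) = ∑ a, c a * spinAt (x a) σ := by
    intro σ
    rw [hlayer σ 0]
    simp only [Pi.single_zero, add_zero]
  simp_rw [hlayer0, hlayer]
  -- both sides are `∑_{a,b} c_a c_b ∑_σ w σ_{x_a} σ_{x_b + n e_i}`
  set w : SpinConfig (TorusSite (d' + 1) N) → ℝ := fun σ =>
    Real.exp (-β * isingHamiltonian (torusGraph (d' + 1) N) Finset.univ 0 .free σ) with hw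
  have hR : ∑ σ, w σ * ((∑ a, c a * spinAt (x a) σ) * ∑ b, c b * spinAt (x b + Pi.single i n) σ) =
      ∑ a, ∑ b, c a * c b * ∑ σ, w σ * (spinAt (x a) σ * spinAt (x b + Pi.single i n) σ) := by
    calc ∑ σ, w σ * ((∑ a, c a * spinAt (x a) σ) * ∑ b, c b * spinAt (x b + Pi.single i n) σ)
        = ∑ σ, ∑ a, ∑ b, c a * c b * (w σ * (spinAt (x a) σ * spinAt (x b + Pi.single i n) σ)) := by
          refine Finset.sum_congr rfl fun σ _ => ?_
          rw [Finset.sum_mul_sum, Finset.mul_sum]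
          refine Finset.sum_congr rfl fun a _ => ?_
          rw [Finset.mul_sum]
          refine Finset.sum_congr rfl fun b _ => ?_
          ring
      _ = ∑ a, ∑ σ, ∑ b, c a * c b * (w σ * (spinAt (x a) σ * spinAt (x b + Pi.single i n) σ)) := by
          rw [Finset.sum_comm]
      _ = ∑ a, ∑ b, ∑ σ, c a * c b * (w σ * (spinAt (x a) σ * spinAt (x b + Pi.single i n) σ)) := by
          refine Finset.sum_congr rfl fun a _ => ?_
          rw [Finset.sum_comm]
      _ = _ := by
          refine Finset.sum_congr rfl fun a _ => Finset.sum_congr rfl fun b _ => ?_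
          rw [Finset.mul_sum]
  have hL : isingPartitionFunction (torusGraph (d' + 1) N) Finset.univ β 0 .free * torusAxisForm β i c x n =
      ∑ a, ∑ b, c a * c b * ∑ σ, w σ * (spinAt (x a) σ * spinAt (x b + Pi.single i n) σ) := by
    rw [torusAxisForm, Finset.mul_sum]
    refine Finset.sum_congr rfl fun a _ => ?_
    rw [Finset.mul_sum]
    refine Finset.sum_congr rfl fun b _ => ?_
    rw [isingTorusTwoPoint_eq_sum]
    simp only [torusWeight, hw]
    field_simp
  rw [hL, ← hR]

/-- **Exact log-convexity of the axis form on the torus** (the finite-volume spectral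
representation, ADC Prop. 5.3 / Prop. A.6, and "Cauchy–Schwarz gives `w_n² ≤ w_{n-1} w_{n+1}`",
proof of Prop. 5.9): for `N ≥ 3`, `β ≥ 0`, sites `x_a` in the layer `{x_i = 0}` and
`1 ≤ n ≤ N - 2`, `W_N(n)² ≤ W_N(n-1) W_N(n+1)`. [cite: AizenmanDuminilCopinAnnals2021, arXiv:1912.07973 Prop. 5.3 with Prop. A.6, and §5.5 proof of Prop. 5.9 (p. 19)] -/
theorem torusAxisForm_sq_le (hN : 3 ≤ N) {β : ℝ} (hβ : 0 ≤ β) (i : Fin (d' + 1)) {ι : Type*} [Fintype ι]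
    (c : ι → ℝ) (x : ι → TorusSite (d' + 1) N) (hx : ∀ a, x a i = 0) {n : ℕ} (hn : 1 ≤ n)
    (hnN : n + 1 < N) :
    torusAxisForm β i c x (n : ZMod N) ^ 2 ≤
      torusAxisForm β i c x ((n - 1 : ℕ) : ZMod N) * torusAxisForm β i c x ((n + 1 : ℕ) : ZMod N) := by
  classical
  set Z := isingPartitionFunction (torusGraph (d' + 1) N) Finset.univ β 0 .free with hZ
  have hZpos : 0 < Z := isingPartitionFunction_pos _ _ β 0 _
  set F : Layer d' N → ℝ := fun r => ∑ a, c a * spinAt (i.removeNth (x a)) r with hF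
  obtain ⟨ev, cc, hev, hcc, -, hspec⟩ :=
    trace_diagonal_pow_diagonal_pow_eq_sum (transferMatrix_posSemidef (d' := d') (N := N) hβ 0) F
  -- `Z W_N(m) = ∑ cc λ_l^m λ_k^{N-m}` for `m < N`
  have hval : ∀ m : ℕ, m < N → ((m : ZMod N)).val = m := fun m hm => ZMod.val_cast_of_lt hm
  have hrep : ∀ m : ℕ, m < N →
      Z * torusAxisForm β i c x (m : ZMod N) = ∑ k, ∑ l, cc k l * (ev l ^ m * ev k ^ (N - m)) := by
    intro m hm
    rw [hZ, Z_mul_torusAxisForm_eq_trace hN β i c x hx, hval m hm]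
    exact hspec m (N - m)
  have h0 := hrep n (by omega)
  have h1 := hrep (n - 1) (by omega)
  have h2 := hrep (n + 1) hnN
  have key := spectralSum_sq_le cc ev hcc hev hn hnN.le
  rw [← h0, ← h1, ← h2] at key
  -- divide by `Z² > 0`
  have hZ2 : 0 < Z ^ 2 := by positivity
  have : Z ^ 2 * torusAxisForm β i c x (n : ZMod N) ^ 2 ≤
      Z ^ 2 * (torusAxisForm β i c x ((n - 1 : ℕ) : ZMod N) * torusAxisForm β i c x ((n + 1 : ℕ) : ZMod N)) := by
    calc Z ^ 2 * torusAxisForm β i c x (n : ZMod N) ^ 2 = (Z * torusAxisForm β i c x (n : ZMod N)) ^ 2 := by ring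
      _ ≤ _ := key
      _ = _ := by ring
  exact le_of_mul_le_mul_left this hZ2

end Torus

/-! ### Part 3. Infinite volume: log-convexity of axis forms of `⟨σ₀σ_x⟩⁺_β` when `m*(β) = 0` -/

section Lattice

variable {d' : ℕ}

/-- **Pointwise convergence of the periodic two-point function when `m*(β) = 0`** (ADC 2021,
Prop. 5.2, second item; from `TorusTwoPointLimit`, in `Tendsto` form along any tori `N_j → ∞`):
`⟨σ₀σ_{x̄}⟩_{𝕋_{N_j};β} → ⟨σ₀σ_x⟩⁺_β`. Covers every `β < β_c`, and `β = β_c` for `d ≥ 3`.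
[cite: AizenmanDuminilCopinAnnals2021, arXiv:1912.07973 Prop. 5.2 (p. 17)] -/
theorem tendsto_isingTorusTwoPoint_proj_of_magnetization_eq_zero {d : ℕ} {β : ℝ} (hβ : 0 ≤ β)
    (hm : spontaneousMagnetization d β = 0) {Nseq : ℕ → ℕ} [∀ j, NeZero (Nseq j)]
    (hN : Tendsto Nseq atTop atTop) (x : Site d) :
    Tendsto (fun j => isingTorusTwoPoint d (Nseq j) β 0 0 (Torus.proj (Nseq j) x)) atTop
      (𝓝 (twoPointPlus d β x)) := by
  rcases eq_or_ne x 0 with rfl | hx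
  · have : ∀ j, isingTorusTwoPoint d (Nseq j) β 0 0 (Torus.proj (Nseq j) 0) = 1 := fun j => by
      rw [show Torus.proj (Nseq j) (0 : Site d) = 0 from (by funext i; simp)]
      simp [isingTorusTwoPoint]
    simp only [this, twoPointPlus_zero]
    exact tendsto_const_nhds
  · rw [Metric.tendsto_atTop]
    intro ε hε
    obtain ⟨N₀, hN₀⟩ := abs_isingTorusTwoPoint_sub_plusCorr_le_of_spontaneousMagnetization_eq_zero hβ hm
      (x := 0) (y := x) hx.symm (half_pos hε)
    obtain ⟨j₀, hj₀⟩ := eventually_atTop.1 (hN.eventually (eventually_ge_atTop N₀))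
    refine ⟨j₀, fun j hj => ?_⟩
    have key := hN₀ (Nseq j) (hj₀ j hj)
    rw [show Torus.proj (Nseq j) (0 : Site d) = 0 from (by funext i; simp)] at key
    rw [Real.dist_eq, twoPointPlus_eq_plusCorr_pair β hx]
    exact key.trans_lt (half_lt_self hε)

/-- `Torus.proj` is additive. [folklore] -/
theorem Torus.proj_add {d : ℕ} (N : ℕ) (x y : Site d) : Torus.proj N (x + y) = Torus.proj N x + Torus.proj N y := by
  funext i
  simp

/-- `Torus.proj` is compatible with subtraction. [folklore] -/
theorem Torus.proj_sub {d : ℕ} (N : ℕ) (x y : Site d) : Torus.proj N (x - y) = Torus.proj N x - Torus.proj N y := by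
  funext i
  simp

/-- `Torus.proj` of a coordinate vector. [folklore] -/
theorem Torus.proj_single {d : ℕ} (N : ℕ) (i : Fin d) (m : ℤ) :
    Torus.proj N (Pi.single i m : Site d) = Pi.single i (m : ZMod N) := by
  funext j
  by_cases h : j = i
  · subst h; simp
  · simp [h]

/-- **The axis form of the infinite-volume two-point function** in the direction `e_i`: for real
coefficients `c_a` at lattice points `x_a`,
`W(n) = ∑_{a,b} c_a c_b S(x_b - x_a + n e_i)` with `S = ⟨σ₀σ_·⟩⁺_β` (the left-hand side of the
spectral representation (5.17) for the finitely supported `v = ∑_a c_a δ_{x_a}`).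
[cite: AizenmanDuminilCopinAnnals2021, arXiv:1912.07973 Prop. 5.3, eq. (5.17)] -/
def axisForm (β : ℝ) (i : Fin (d' + 1)) {ι : Type*} [Fintype ι] (c : ι → ℝ) (x : ι → Site (d' + 1))
    (n : ℕ) : ℝ :=
  ∑ a, ∑ b, c a * c b * twoPointPlus (d' + 1) β (x b - x a + Pi.single i (n : ℤ))

/-- The torus axis form at the projected sites converges to the infinite-volume axis form
(termwise convergence of the periodic two-point function, `m*(β) = 0`). [cite: AizenmanDuminilCopinAnnals2021, arXiv:1912.07973 Prop. 5.2 (p. 17)] -/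
theorem tendsto_torusAxisForm {β : ℝ} (hβ : 0 ≤ β) (hm : spontaneousMagnetization (d' + 1) β = 0)
    (i : Fin (d' + 1)) {ι : Type*} [Fintype ι] (c : ι → ℝ) (x : ι → Site (d' + 1)) (n : ℕ) :
    Tendsto (fun j : ℕ => torusAxisForm (N := j + 3) β i c (fun a => Torus.proj (j + 3) (x a)) ((n : ℕ) : ZMod (j + 3)))
      atTop (𝓝 (axisForm β i c x n)) := by
  classical
  unfold torusAxisForm axisForm
  refine tendsto_finsetSum _ fun a _ => tendsto_finsetSum _ fun b _ => ?_
  refine Tendsto.const_mul _ ?_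
  have hN : Tendsto (fun j : ℕ => j + 3) atTop atTop := tendsto_add_atTop_nat 3
  have key := tendsto_isingTorusTwoPoint_proj_of_magnetization_eq_zero (Nseq := fun j => j + 3) hβ hm hN
    (x b - x a + Pi.single i (n : ℤ))
  refine key.congr fun j => ?_
  have hsite : Torus.proj (j + 3) (x b - x a + Pi.single i (n : ℤ)) =
      Torus.proj (j + 3) (x b) + Pi.single i ((n : ℕ) : ZMod (j + 3)) - Torus.proj (j + 3) (x a) := by
    rw [Torus.proj_add, Torus.proj_sub, Torus.proj_single, Int.cast_natCast]
    abel
  rw [hsite, ← isingTorusTwoPoint_eq_zero_sub]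

/-- **Log-convexity of axis forms of the two-point function** (Aizenman–Duminil-Copin 2021,
Prop. 5.3 as used in the proof of Prop. 5.9: "`w_n = ∫ e^{-na} dμ(a)` … Cauchy–Schwarz gives
`w_n² ≤ w_{n-1} w_{n+1}`"), for the nearest-neighbour Ising model on `ℤ^{d'+1}` at `β ≥ 0` with
`m*(β) = 0` (all `β < β_c`; `β = β_c` for `d' + 1 ≥ 3`): for real coefficients `c_a` at lattice
points `x_a` of the hyperplane `{x_i = 0}` and `W(n) = ∑_{a,b} c_a c_b ⟨σ₀ σ_{x_b - x_a + n e_i}⟩⁺_β`,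
`W(n)² ≤ W(n-1) W(n+1)` for every `n ≥ 1`. Proof: the exact torus statement `torusAxisForm_sq_le`
and the limit `N → ∞`. [cite: AizenmanDuminilCopinAnnals2021, arXiv:1912.07973 Prop. 5.3 (5.17) and §5.5 proof of Prop. 5.9 (p. 19)] -/
theorem axisForm_sq_le {β : ℝ} (hβ : 0 ≤ β) (hm : spontaneousMagnetization (d' + 1) β = 0)
    (i : Fin (d' + 1)) {ι : Type*} [Fintype ι] (c : ι → ℝ) (x : ι → Site (d' + 1)) (hx : ∀ a, x a i = 0)
    {n : ℕ} (hn : 1 ≤ n) :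
    axisForm β i c x n ^ 2 ≤ axisForm β i c x (n - 1) * axisForm β i c x (n + 1) := by
  classical
  have hT := fun m => tendsto_torusAxisForm hβ hm i c x m
  have hlim1 : Tendsto (fun j : ℕ => torusAxisForm (N := j + 3) β i c (fun a => Torus.proj (j + 3) (x a))
      ((n : ℕ) : ZMod (j + 3)) ^ 2) atTop (𝓝 (axisForm β i c x n ^ 2)) := (hT n).pow 2
  have hlim2 : Tendsto (fun j : ℕ =>
      torusAxisForm (N := j + 3) β i c (fun a => Torus.proj (j + 3) (x a)) ((n - 1 : ℕ) : ZMod (j + 3)) *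
        torusAxisForm (N := j + 3) β i c (fun a => Torus.proj (j + 3) (x a)) ((n + 1 : ℕ) : ZMod (j + 3)))
      atTop (𝓝 (axisForm β i c x (n - 1) * axisForm β i c x (n + 1))) := (hT (n - 1)).mul (hT (n + 1))
  refine le_of_tendsto_of_tendsto hlim1 hlim2 ?_
  rw [EventuallyLE, eventually_atTop]
  refine ⟨n, fun j hj => ?_⟩
  have hproj : ∀ a, Torus.proj (j + 3) (x a) i = 0 := fun a => by simp [hx a]
  exact torusAxisForm_sq_le (N := j + 3) (by omega) hβ i c _ hproj hn (by omega)

/-- **The instance used in the proof of Prop. 5.9** ("`v` being the sum of the Dirac functions at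
`0_⊥` and `x_⊥`"): for `x_⊥` in the hyperplane `{x_i = 0}`, with `u_n = ⟨σ₀σ_{n e_i}⟩⁺_β` and
`v_n = ⟨σ₀σ_{x_⊥ + n e_i}⟩⁺_β`, the sequence `w_n = u_n + v_n` is log-convex:
`w_n² ≤ w_{n-1} w_{n+1}` for `n ≥ 1` (`β ≥ 0`, `m*(β) = 0`). [cite: AizenmanDuminilCopinAnnals2021, arXiv:1912.07973 §5.5, proof of Prop. 5.9 (w_n² ≤ w_{n-1}w_{n+1}) (p. 19)] -/
theorem twoPointPlus_axisPair_sq_le {β : ℝ} (hβ : 0 ≤ β) (hm : spontaneousMagnetization (d' + 1) β = 0)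
    (i : Fin (d' + 1)) (xp : Site (d' + 1)) (hxp : xp i = 0) {n : ℕ} (hn : 1 ≤ n) :
    (twoPointPlus (d' + 1) β (Pi.single i (n : ℤ)) + twoPointPlus (d' + 1) β (xp + Pi.single i (n : ℤ))) ^ 2 ≤
      (twoPointPlus (d' + 1) β (Pi.single i ((n - 1 : ℕ) : ℤ)) +
          twoPointPlus (d' + 1) β (xp + Pi.single i ((n - 1 : ℕ) : ℤ))) *
        (twoPointPlus (d' + 1) β (Pi.single i ((n + 1 : ℕ) : ℤ)) +
          twoPointPlus (d' + 1) β (xp + Pi.single i ((n + 1 : ℕ) : ℤ))) := by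
  classical
  -- the form with `c = (1, 1)` at the points `0, x_⊥` is `2 w_n`
  set x : Fin 2 → Site (d' + 1) := ![0, xp] with hxdef
  have hx : ∀ a, x a i = 0 := fun a => by fin_cases a <;> simp [hxdef, hxp]
  have hform : ∀ m : ℕ, axisForm β i (fun _ : Fin 2 => (1 : ℝ)) x m =
      2 * (twoPointPlus (d' + 1) β (Pi.single i (m : ℤ)) + twoPointPlus (d' + 1) β (xp + Pi.single i (m : ℤ))) := by
    intro m
    have hrefl : twoPointPlus (d' + 1) β (0 - xp + Pi.single i (m : ℤ)) =
        twoPointPlus (d' + 1) β (xp + Pi.single i (m : ℤ)) := by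
      -- reflect all coordinates, then un-reflect the coordinate `i` (where `xp_i = 0`)
      have h1 := twoPointPlus_neg β (0 - xp + Pi.single i (m : ℤ))
      have h2 := twoPointPlus_reflection_invariant_holds (d := d' + 1) hβ i (-(0 - xp + Pi.single i (m : ℤ)))
      rw [← h1, ← h2]
      congr 1
      funext j
      by_cases hj : j = i
      · subst hj; simp [hxp]
      · simp [hj]
    simp only [axisForm, Fin.sum_univ_two, one_mul, hxdef, Matrix.cons_val_zero, Matrix.cons_val_one,
      sub_zero, sub_self, zero_add, hrefl]
    ring
  have key := axisForm_sq_le hβ hm i (fun _ : Fin 2 => (1 : ℝ)) x hx hn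
  rw [hform, hform, hform] at key
  nlinarith [key]

end Lattice

end Literature.Probability.LatticeModels

end
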